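import Mathlib
import HarnessLib
import Summits.Ventures.LatticeQCDFlow.Exactness.SphereTiltedGreen
import Summits.Ventures.LatticeQCDFlow.Exactness.SphereNLOFlowGeneratorClosed

/-!
# The null space of Lüscher's operator `𝓛_t` on the lattice of site spheres is the constants; the flow action at flow time `t` is unique up to a constant and its constant is forced: `C·∫e^{−tS}dπ̄ = −∫R e^{−tS}dπ̄`

HONEST FRAMING: exact (Metropolis-corrected) sampling algorithms for lattice gauge theory;
figures of merit are autocorrelation/cost numbers at stated couplings and volumes; no
continuum-physics claim.

Venture `LatticeQCDFlow` (cell pub-lqcd), topic `Exactness`; FANOUT row 7 (`s0-cpn-null`).  NEW WORK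
of the cell over the tree's `Exactness/SphereTiltedGreen.lean` (this leg: `sphereLuscherL`, the
tilted Green identity, the energy identity `∫e^{−tS}F·𝓛_tF dπ̄ = Σ_n∫e^{−tS}‖∂̃_nF‖²dπ̄` and
`∫e^{−tS}𝓛_tF dπ̄ = 0`), `Exactness/SphereLatticeLuscherKernel.lean` (GEN-8: `∂̃F ≡ 0` on `Ω` forces
`F` constant on `Ω` when `d ≥ 2` — one site at a time along great circles),
`Exactness/SphereSiteLaplacianCalculus.lean` / `SphereNLOFlowGenerator(Closed).lean` (linearity of
`∂̃²`, `∂̃` in the functional) and `Exactness/LatticeCoordAvg.lean` (`integrable_pi_of_continuous`);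
nothing is cited as a fact.  Printed counterpart, NAMED ONLY: M. Lüscher, Commun. Math. Phys. 293
(2010) 899, §4.2: after eq. (4.8), "the only zero modes of `𝓛_t` are the constant functions", so the
flow equation `𝓛_tS̃_t = S + Ċ_t` (4.5) determines `S̃_t` up to an (irrelevant) additive constant and
`Ċ_t = −(1, S)_t/(1, 1)_t` (4.9).  The tree had this at `t = 0` only (`luscher_poisson_unique`,
`loFlowAction_unique`); here it is proved AT EVERY REAL FLOW TIME `t`, for every `C¹` action `S` on
`Ω = S(E)^Λ` (`E` a finite-dimensional real inner product space, `d = dim E ≥ 2`, `Λ` finite).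

## Content

* §1 **`siteGrad_eq_zero_of_sphereLuscherL_eq_zero`** (`𝓛_tF = 0` on `Ω` ⇒ every `∂̃_nF = 0` on `Ω`:
  the energy identity has a positive continuous weight and `π̄` charges every open set) and
  **`eq_of_sphereLuscherL_eq_zero`** — THE NULL SPACE OF `𝓛_t` ON `C²(Ω)` IS THE CONSTANTS.
* §2 `𝓛_t` is linear in the functional on `Ω`: `sphereLuscherL_const`, `sphereLuscherL_add`,
  `sphereLuscherL_const_mul`, `sphereLuscherL_sub`, `sphereLuscherL_finset_sum` (used by the sequel to
  apply `𝓛_t` to the partial sums `Σ_{k≤K} t^k S̃⁽ᵏ⁾` of a Lüscher series).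
* §3 **`integral_exp_neg_mul_pos`** (`0 < ∫e^{−tS}dπ̄`), **`sphereLuscherL_constant_eq`** (if
  `𝓛_tF = R + C` on `Ω` then `C·∫e^{−tS}dπ̄ = −∫e^{−tS}R dπ̄`, i.e. `C = −⟨R⟩_{e^{−tS}π̄}` —
  `sphereLuscherL_constant_eq_div`), and **`sphereLuscherL_poisson_unique`**: two `C²` solutions of
  `𝓛_tF_i = R + C_i` on `Ω` have `C₁ = C₂` and `F₁ − F₂` constant on `Ω` — uniqueness of the
  finite-`t` flow action up to constants, the `t ≠ 0` counterpart of GEN-8's `luscher_poisson_unique`.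

NOT CLAIMED: existence of the finite-`t` flow action (Lüscher App. E / a spectral gap for `𝓛_t`),
anything about the flow map or its Jacobian, convergence of the series, the rung's numbers.
-/

noncomputable section

namespace Summit.Ventures.LatticeQCDFlow.Exactness

open Function Set Metric MeasureTheory NormedSpace InnerProductSpace
open scoped RealInnerProductSpace

variable {Λ : Type*} {E : Type*} [NormedAddCommGroup E] [InnerProductSpace ℝ E]
  [FiniteDimensional ℝ E] [Fintype Λ] [DecidableEq Λ]

/-! ## §1 The null space of `𝓛_t` is the constants -/

section Kernel

variable [MeasurableSpace E] [BorelSpace E]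

/-- **`𝓛_tF = 0` on `Ω` forces `∂̃_nF = 0` on `Ω`** (energy identity: `Σ_n∫e^{−tS}‖∂̃_nF‖²dπ̄ = 0`
with a positive continuous weight against a measure charging every open set). -/
theorem siteGrad_eq_zero_of_sphereLuscherL_eq_zero [Nontrivial E] {S F : (Λ → E) → ℝ}
    (hS : ContDiff ℝ 1 S) (hF : ContDiff ℝ 2 F) {t : ℝ}
    (h0 : ∀ ω : Λ → sphere (0 : E) 1, sphereLuscherL S t F (fun m => (ω m : E)) = 0) (n : Λ)
    (ω : Λ → sphere (0 : E) 1) : siteGrad n F (fun m => (ω m : E)) = 0 := by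
  set μ : Measure (sphere (0 : E) 1) := uniformSphere (volume : Measure E) with hμ
  have hE := integral_exp_mul_self_sphereLuscherL (Λ := Λ) hS hF t
  have hL : ∫ ω, Real.exp (-(t * S (fun m => ((ω : Λ → sphere (0 : E) 1) m : E)))) *
      F (fun m => (ω m : E)) * sphereLuscherL S t F (fun m => (ω m : E))
        ∂Measure.pi (fun _ : Λ => μ) = 0 := by
    simp [h0]
  rw [hL] at hE
  have hcont : ∀ k, Continuous fun ω : Λ → sphere (0 : E) 1 =>
      Real.exp (-(t * S (fun m => (ω m : E)))) * ‖siteGrad k F (fun m => (ω m : E))‖ ^ 2 :=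
    fun k => (continuous_exp_neg_mul_sphereConfig hS.continuous t).mul
      (((continuous_siteGrad_sphereConfig (hF.of_le (by norm_num)) k).norm).pow 2)
  have hnn : ∀ k, 0 ≤ ∫ ω, Real.exp (-(t * S (fun m => ((ω : Λ → sphere (0 : E) 1) m : E)))) *
      ‖siteGrad k F (fun m => (ω m : E))‖ ^ 2 ∂Measure.pi (fun _ : Λ => μ) :=
    fun k => integral_nonneg fun ω => mul_nonneg (Real.exp_pos _).le (sq_nonneg _)
  have hk := (Finset.sum_eq_zero_iff_of_nonneg fun k _ => hnn k).1 hE.symm n (Finset.mem_univ n)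
  have hint : Integrable (fun ω : Λ → sphere (0 : E) 1 =>
      Real.exp (-(t * S (fun m => (ω m : E)))) * ‖siteGrad n F (fun m => (ω m : E))‖ ^ 2)
        (Measure.pi fun _ : Λ => μ) := integrable_pi_of_continuous μ (hcont n)
  have hae := (integral_eq_zero_iff_of_nonneg
    (fun ω => mul_nonneg (Real.exp_pos _).le (sq_nonneg _)) hint).1 hk
  haveI : (uniformSphere (volume : Measure E)).IsOpenPosMeasure := by
    rw [uniformSphere]
    exact Measure.isOpenPosMeasure_smul _ (ENNReal.inv_ne_zero.2 (measure_ne_top _ _))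
  haveI := Measure.pi.isOpenPosMeasure (fun _ : Λ => μ)
  have hzero := (Continuous.ae_eq_iff_eq (Measure.pi fun _ : Λ => μ) (hcont n)
    (continuous_const : Continuous fun _ : Λ → sphere (0 : E) 1 => (0 : ℝ))).1 hae
  have h' : Real.exp (-(t * S (fun m => (ω m : E)))) *
      ‖siteGrad n F (fun m => (ω m : E))‖ ^ 2 = 0 := congrFun hzero ω
  rcases mul_eq_zero.1 h' with h1 | h2
  · exact absurd h1 (Real.exp_pos _).ne'
  · exact norm_eq_zero.1 ((pow_eq_zero_iff two_ne_zero).1 h2)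

/-- **THE NULL SPACE OF `𝓛_t` IS THE CONSTANTS** (`d ≥ 2`): a `C²` functional with `𝓛_tF = 0` on `Ω`
is constant on `Ω` — at every real flow time `t`, for every `C¹` action `S`. -/
theorem eq_of_sphereLuscherL_eq_zero (h2 : 2 ≤ Module.finrank ℝ E) {S F : (Λ → E) → ℝ}
    (hS : ContDiff ℝ 1 S) (hF : ContDiff ℝ 2 F) {t : ℝ}
    (h0 : ∀ ω : Λ → sphere (0 : E) 1, sphereLuscherL S t F (fun m => (ω m : E)) = 0)
    (ω ω' : Λ → sphere (0 : E) 1) : F (fun m => (ω m : E)) = F (fun m => (ω' m : E)) := by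
  haveI : Nontrivial E := Module.nontrivial_of_finrank_pos (R := ℝ) (by omega)
  exact eq_of_siteGrad_eq_zero h2 (hF.of_le (by norm_num))
    (fun k ξ => siteGrad_eq_zero_of_sphereLuscherL_eq_zero hS hF h0 k ξ) ω ω'

end Kernel

/-! ## §2 `𝓛_t` is linear in the functional (on `Ω`) -/

section Linear

variable {S : (Λ → E) → ℝ} (t : ℝ)

/-- `𝓛_t` of a constant functional vanishes. -/
theorem sphereLuscherL_const (c : ℝ) (ω : Λ → sphere (0 : E) 1) :
    sphereLuscherL S t (fun _ => c) (fun m => (ω m : E)) = 0 := by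
  rw [sphereLuscherL_apply]
  have hL : ∀ n, siteLaplacian n (fun _ : Λ → E => c) (fun m => (ω m : E)) = 0 := fun n =>
    siteLaplacian_of_const (c := c) fun _ => rfl
  have hG : ∀ n, siteGrad n (fun _ : Λ → E => c) (fun m => (ω m : E)) = 0 := fun n =>
    siteGrad_of_const (c := c) fun _ => rfl
  simp [hL, hG]

/-- `𝓛_t (F + G) = 𝓛_t F + 𝓛_t G` on `Ω` (`F, G ∈ C²`). -/
theorem sphereLuscherL_add {F G : (Λ → E) → ℝ} (hF : ContDiff ℝ 2 F) (hG : ContDiff ℝ 2 G)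
    (ω : Λ → sphere (0 : E) 1) :
    sphereLuscherL S t (fun z => F z + G z) (fun m => (ω m : E)) =
      sphereLuscherL S t F (fun m => (ω m : E)) + sphereLuscherL S t G (fun m => (ω m : E)) := by
  simp only [sphereLuscherL_apply]
  have hL : ∀ n, siteLaplacian n (fun z => F z + G z) (fun m => (ω m : E)) =
      siteLaplacian n F (fun m => (ω m : E)) + siteLaplacian n G (fun m => (ω m : E)) := fun n =>
    siteLaplacian_add (G := F) (H := G) (x := fun m => (ω m : E)) (n := n)
      (sphereConfig_ne_zero ω n) (contDiff_comp_update hF _ n) (contDiff_comp_update hG _ n)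
  have hD : ∀ n, siteGrad n (fun z => F z + G z) (fun m => (ω m : E)) =
      siteGrad n F (fun m => (ω m : E)) + siteGrad n G (fun m => (ω m : E)) := fun n =>
    siteGrad_add (x := fun m => (ω m : E)) (sphereConfig_ne_zero ω n)
      (contDiff_comp_update (hF.of_le (by norm_num)) _ n)
      (contDiff_comp_update (hG.of_le (by norm_num)) _ n)
  simp_rw [hL, hD, inner_add_right, Finset.sum_add_distrib]
  ring

/-- `𝓛_t (a·F) = a·𝓛_t F` on `Ω` (`F ∈ C²`). -/
theorem sphereLuscherL_const_mul {F : (Λ → E) → ℝ} (hF : ContDiff ℝ 2 F) (a : ℝ)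
    (ω : Λ → sphere (0 : E) 1) :
    sphereLuscherL S t (fun z => a * F z) (fun m => (ω m : E)) =
      a * sphereLuscherL S t F (fun m => (ω m : E)) := by
  simp only [sphereLuscherL_apply]
  have hL : ∀ n, siteLaplacian n (fun z => a * F z) (fun m => (ω m : E)) =
      a * siteLaplacian n F (fun m => (ω m : E)) := fun n =>
    siteLaplacian_const_mul (G := F) (x := fun m => (ω m : E)) (n := n)
      (sphereConfig_ne_zero ω n) (contDiff_comp_update hF _ n) a
  have hD : ∀ n, siteGrad n (fun z => a * F z) (fun m => (ω m : E)) =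
      a • siteGrad n F (fun m => (ω m : E)) := fun n =>
    siteGrad_const_mul (x := fun m => (ω m : E)) (sphereConfig_ne_zero ω n)
      (contDiff_comp_update (hF.of_le (by norm_num)) _ n) a
  simp_rw [hL, hD, real_inner_smul_right, ← Finset.mul_sum]
  ring

/-- `𝓛_t (F − G) = 𝓛_t F − 𝓛_t G` on `Ω` (`F, G ∈ C²`). -/
theorem sphereLuscherL_sub {F G : (Λ → E) → ℝ} (hF : ContDiff ℝ 2 F) (hG : ContDiff ℝ 2 G)
    (ω : Λ → sphere (0 : E) 1) :
    sphereLuscherL S t (fun z => F z - G z) (fun m => (ω m : E)) =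
      sphereLuscherL S t F (fun m => (ω m : E)) - sphereLuscherL S t G (fun m => (ω m : E)) := by
  have hfun : (fun z => F z - G z) = fun z => F z + (-1 : ℝ) * G z := by
    funext z; ring
  rw [hfun, sphereLuscherL_add t hF (contDiff_const.mul hG) ω,
    sphereLuscherL_const_mul t hG (-1) ω]
  ring

/-- `𝓛_t (Σ_{i∈s} F_i) = Σ_{i∈s} 𝓛_t F_i` on `Ω` (`F_i ∈ C²`). -/
theorem sphereLuscherL_finset_sum {ι : Type*} (s : Finset ι) {F : ι → (Λ → E) → ℝ}
    (hF : ∀ i ∈ s, ContDiff ℝ 2 (F i)) (ω : Λ → sphere (0 : E) 1) :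
    sphereLuscherL S t (fun z => ∑ i ∈ s, F i z) (fun m => (ω m : E)) =
      ∑ i ∈ s, sphereLuscherL S t (F i) (fun m => (ω m : E)) := by
  classical
  induction s using Finset.induction_on with
  | empty =>
    simp only [Finset.sum_empty]
    exact sphereLuscherL_const t 0 ω
  | @insert i s hi ih =>
    have hFi : ContDiff ℝ 2 (F i) := hF i (Finset.mem_insert_self i s)
    have hFs : ∀ j ∈ s, ContDiff ℝ 2 (F j) := fun j hj => hF j (Finset.mem_insert_of_mem hj)
    have hsum : ContDiff ℝ 2 (fun z => ∑ j ∈ s, F j z) := ContDiff.sum fun j hj => hFs j hj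
    simp_rw [Finset.sum_insert hi]
    rw [sphereLuscherL_add t hFi hsum ω, ih hFs]

end Linear

/-! ## §3 The constant is forced; uniqueness of the finite-`t` flow action up to constants -/

section Unique

variable [MeasurableSpace E] [BorelSpace E] [Nontrivial E]

omit [DecidableEq Λ] in
/-- **`0 < ∫ e^{−tS} dπ̄`**: the tilted normalisation is positive (continuous `S`). -/
theorem integral_exp_neg_mul_pos {S : (Λ → E) → ℝ} (hS : Continuous S) (t : ℝ) :
    0 < ∫ ω, Real.exp (-(t * S (fun m => ((ω : Λ → sphere (0 : E) 1) m : E))))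
      ∂Measure.pi (fun _ : Λ => uniformSphere (volume : Measure E)) :=
  integral_exp_pos (integrable_pi_of_continuous _ (continuous_exp_neg_mul_sphereConfig hS t))

/-- **THE CONSTANT OF THE FLOW EQUATION IS FORCED** (Lüscher's (4.9) at flow time `t`): if a `C²`
functional solves `𝓛_tF = R + C` on `Ω` (`S ∈ C¹`, `R` continuous), then
`C · ∫e^{−tS}dπ̄ = −∫ e^{−tS}R dπ̄` — integrate against `e^{−tS}π̄` and use `∫e^{−tS}𝓛_tF dπ̄ = 0`. -/
theorem sphereLuscherL_constant_eq {S F R : (Λ → E) → ℝ} (hS : ContDiff ℝ 1 S)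
    (hF : ContDiff ℝ 2 F) (hR : Continuous R) {t C : ℝ}
    (h : ∀ ω : Λ → sphere (0 : E) 1,
      sphereLuscherL S t F (fun m => (ω m : E)) = R (fun m => (ω m : E)) + C) :
    C * ∫ ω, Real.exp (-(t * S (fun m => ((ω : Λ → sphere (0 : E) 1) m : E))))
        ∂Measure.pi (fun _ : Λ => uniformSphere (volume : Measure E)) =
      -∫ ω, Real.exp (-(t * S (fun m => ((ω : Λ → sphere (0 : E) 1) m : E)))) *
          R (fun m => (ω m : E)) ∂Measure.pi (fun _ : Λ => uniformSphere (volume : Measure E)) := by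
  set μ : Measure (sphere (0 : E) 1) := uniformSphere (volume : Measure E) with hμ
  have h0 := integral_exp_mul_sphereLuscherL_eq_zero (Λ := Λ) hS hF t
  have hW := continuous_exp_neg_mul_sphereConfig (Λ := Λ) hS.continuous t
  have hi1 : Integrable (fun ω : Λ → sphere (0 : E) 1 =>
      Real.exp (-(t * S (fun m => (ω m : E)))) * R (fun m => (ω m : E))) (Measure.pi fun _ : Λ => μ) :=
    integrable_pi_of_continuous μ (hW.mul (hR.comp continuous_sphereConfig))
  have hi2 : Integrable (fun ω : Λ → sphere (0 : E) 1 =>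
      C * Real.exp (-(t * S (fun m => (ω m : E))))) (Measure.pi fun _ : Λ => μ) :=
    (integrable_pi_of_continuous μ hW).const_mul C
  have hsplit : ∀ ω : Λ → sphere (0 : E) 1,
      Real.exp (-(t * S (fun m => (ω m : E)))) * sphereLuscherL S t F (fun m => (ω m : E)) =
        Real.exp (-(t * S (fun m => (ω m : E)))) * R (fun m => (ω m : E)) +
          C * Real.exp (-(t * S (fun m => (ω m : E)))) := fun ω => by
    rw [h ω]; ring
  simp_rw [hsplit] at h0
  rw [integral_add hi1 hi2, integral_const_mul] at h0
  linarith

/-- … in ratio form: `C = −(∫e^{−tS}R dπ̄)/(∫e^{−tS}dπ̄) = −⟨R⟩_{e^{−tS}π̄}`. -/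
theorem sphereLuscherL_constant_eq_div {S F R : (Λ → E) → ℝ} (hS : ContDiff ℝ 1 S)
    (hF : ContDiff ℝ 2 F) (hR : Continuous R) {t C : ℝ}
    (h : ∀ ω : Λ → sphere (0 : E) 1,
      sphereLuscherL S t F (fun m => (ω m : E)) = R (fun m => (ω m : E)) + C) :
    C = -(∫ ω, Real.exp (-(t * S (fun m => ((ω : Λ → sphere (0 : E) 1) m : E)))) *
          R (fun m => (ω m : E)) ∂Measure.pi (fun _ : Λ => uniformSphere (volume : Measure E))) /
        ∫ ω, Real.exp (-(t * S (fun m => ((ω : Λ → sphere (0 : E) 1) m : E))))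
          ∂Measure.pi (fun _ : Λ => uniformSphere (volume : Measure E)) := by
  have hZ := integral_exp_neg_mul_pos (Λ := Λ) (E := E) hS.continuous t
  rw [eq_div_iff hZ.ne', sphereLuscherL_constant_eq hS hF hR h]

/-- **UNIQUENESS OF THE FLOW ACTION AT FLOW TIME `t`, UP TO CONSTANTS** (`d ≥ 2`): two `C²` solutions
of `𝓛_tF₁ = R + C₁`, `𝓛_tF₂ = R + C₂` on `Ω` have `C₁ = C₂`, and `F₁ − F₂` is constant on `Ω`. -/
theorem sphereLuscherL_poisson_unique (h2 : 2 ≤ Module.finrank ℝ E) {S F₁ F₂ R : (Λ → E) → ℝ}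
    (hS : ContDiff ℝ 1 S) (hF₁ : ContDiff ℝ 2 F₁) (hF₂ : ContDiff ℝ 2 F₂) (hR : Continuous R)
    {t C₁ C₂ : ℝ}
    (h₁ : ∀ ω : Λ → sphere (0 : E) 1,
      sphereLuscherL S t F₁ (fun m => (ω m : E)) = R (fun m => (ω m : E)) + C₁)
    (h₂ : ∀ ω : Λ → sphere (0 : E) 1,
      sphereLuscherL S t F₂ (fun m => (ω m : E)) = R (fun m => (ω m : E)) + C₂) :
    C₁ = C₂ ∧ ∀ ω ω' : Λ → sphere (0 : E) 1,
      F₁ (fun m => (ω m : E)) - F₂ (fun m => (ω m : E)) =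
        F₁ (fun m => (ω' m : E)) - F₂ (fun m => (ω' m : E)) := by
  have hC : C₁ = C₂ := by
    have e₁ := sphereLuscherL_constant_eq hS hF₁ hR h₁
    have e₂ := sphereLuscherL_constant_eq hS hF₂ hR h₂
    have hZ := integral_exp_neg_mul_pos (Λ := Λ) (E := E) hS.continuous t
    exact mul_right_cancel₀ hZ.ne' (e₁.trans e₂.symm)
  refine ⟨hC, fun ω ω' => ?_⟩
  have h0 : ∀ ξ : Λ → sphere (0 : E) 1,
      sphereLuscherL S t (fun z => F₁ z - F₂ z) (fun m => (ξ m : E)) = 0 := fun ξ => by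
    rw [sphereLuscherL_sub t hF₁ hF₂ ξ, h₁ ξ, h₂ ξ, hC, sub_self]
  exact eq_of_sphereLuscherL_eq_zero h2 hS (hF₁.sub hF₂) h0 ω ω'

end Unique

end Summit.Ventures.LatticeQCDFlow.Exactness

end
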